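/-
Copyright: the b2b-balaban T⁴-continuum CRUX team, row NE7b OWNER lineage `t4-ne7b-p1` (gen 144). Project licence.
-/
import Summits.QuantumFields.BalabanUV.T4Continuum.Spine.NE7b.SupTiltedCumulantCalculusOne

/-!
# THE GROWTH CLASS IS CLOSED UNDER SUMS, DIFFERENCES AND SCALAR MULTIPLES (toward the `C⁵` packaging, SCOPING-d16 (2)).  (513)'s tilted-moment
# calculus and (581)'s cumulant rules take ABSTRACT observables `p` with `|p|, ‖p′‖ ≤ C_p(1+‖U′‖)^{n_p}`; (581) proved the class closed under
# PRODUCTS (`C_{pq} = 2C_pC_q`, `n_{pq} = n_p + n_q`).  The raw order-4 display's composite integrands (`U″mv − U′v·U′m`, the fifteen-term `Ψ`, …)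
# are LINEAR COMBINATIONS of products, so the Fréchet differentiability of their tilted moments ((513) `hasFDerivAt_tilted_moment`) needs the class
# closed under `p + q`, `p − q`, `c·p` as well: `C_{p±q} = C_p + C_q`, `n_{p±q} = n_p + n_q` (since `1 + ‖U′‖ ≥ 1` the exponents only grow),
# `C_{c·p} = |c|·C_p` — values, derivatives and the continuity of the derivative (row NE7b, node U5c; (581) `class_const_nonneg` BY NAME;
# [folklore])

Cell `pub-balaban`, sub-cell `t4`, spine estimate NE7b (`T4WeightBudget.RelWeightBound`; the cell's OWN estimate — NOT PRINTED in
[Bałaban 1983–89], NOT PROVED).  Crux-route work under `Spine/NE7b/` by the row OWNER (`t4-ne7b-p1` gen 144, file (635)) under FREEZE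
(0)'s crux-prover clause; NOTHING of Bałaban's is named as a Lean object, valued or asserted; no `T4Continuum/Support` leaf typed; no
`def`, no notation (the class is a conjunction of hypotheses); zero `sorry`.  Imports (BY NAME): the OWNER's (581) `…SupTiltedCumulantCalculusOne`.

WHAT IS PROVED ([folklore]): `growth_pow_mono`, `class_add_abs_le`, `class_add_fderiv_le`, `class_sub_abs_le`, `class_sub_fderiv_le`,
`class_smul_abs_le`, `class_smul_fderiv_le`, `class_add_fderiv_continuous`, `class_sub_fderiv_continuous`; toy.

HONEST (what this is NOT).  Class algebra only; the composite atoms' differentiability, the `C⁵` packaging and continuity are the next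
files.  Scalar skeleton ((A3), NC-NE7b-α UNRULED); nothing of Bałaban's asserted.  BY-NAME EFFECT ON THE WALL: NONE.  NE7b NOT PRINTED ∕ NOT
PROVED; spine PROVED 0∕9; rung (B)+1 — the programme's measures remain FINITE-torus statements; NOT the mass gap, NOT Clay.  HONEST DEPENDENCY:
continuum YM on T⁴ ⇐ BetaPertH ∧ nine spine estimates (0∕9 proved); BetaPertH ⇐ (D1) ∧ (D4) ∧ CAP+tail; G-an2-4 gates asym, D1 and NE2∕3∕4.
-/

set_option autoImplicit false

noncomputable section

namespace Summit.QuantumFields.BalabanUV.T4Continuum.NE7b.SupGrowthClassLinear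

open SupTiltedCumulantCalculusOne (class_const_nonneg)

variable {ι : Type} [Fintype ι] [DecidableEq ι]

variable {U' : EuclideanSpace ℝ ι → EuclideanSpace ℝ ι →L[ℝ] ℝ} {p q : EuclideanSpace ℝ ι → ℝ}
  {p' q' : EuclideanSpace ℝ ι → EuclideanSpace ℝ ι →L[ℝ] ℝ} {Cp Cq : ℝ} {np nq : ℕ}

omit [DecidableEq ι] in
/-- `(1+‖U′φ‖)^n ≤ (1+‖U′φ‖)^{n+m}` (the base is `≥ 1`). [folklore] -/
theorem growth_pow_mono (φ : EuclideanSpace ℝ ι) (n m : ℕ) : (1 + ‖U' φ‖) ^ n ≤ (1 + ‖U' φ‖) ^ (n + m) :=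
  pow_le_pow_right₀ (by linarith [norm_nonneg (U' φ)]) (Nat.le_add_right n m)

omit [DecidableEq ι] in
/-- **Closed under sums, values**: `|p + q| ≤ (C_p + C_q)(1+‖U′‖)^{n_p+n_q}`. [folklore] -/
theorem class_add_abs_le (hpb : ∀ φ : EuclideanSpace ℝ ι, |p φ| ≤ Cp * (1 + ‖U' φ‖) ^ np) (hqb : ∀ φ : EuclideanSpace ℝ ι, |q φ| ≤ Cq * (1 + ‖U' φ‖)
    ^ nq)
    (φ : EuclideanSpace ℝ ι) : |p φ + q φ| ≤ (Cp + Cq) * (1 + ‖U' φ‖) ^ (np + nq) := by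
  have hCp := class_const_nonneg hpb
  have hCq := class_const_nonneg hqb
  have h1 : |p φ| ≤ Cp * (1 + ‖U' φ‖) ^ (np + nq) := (hpb φ).trans (mul_le_mul_of_nonneg_left (growth_pow_mono φ np nq) hCp)
  have h2 : |q φ| ≤ Cq * (1 + ‖U' φ‖) ^ (np + nq) := by
    have h := (hqb φ).trans (mul_le_mul_of_nonneg_left (growth_pow_mono φ nq np) hCq)
    rwa [Nat.add_comm] at h
  calc |p φ + q φ| ≤ |p φ| + |q φ| := abs_add_le _ _
    _ ≤ (Cp + Cq) * (1 + ‖U' φ‖) ^ (np + nq) := by rw [add_mul]; exact add_le_add h1 h2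

omit [DecidableEq ι] in
/-- **Closed under sums, derivatives**: `‖p′ + q′‖ ≤ (C_p + C_q)(1+‖U′‖)^{n_p+n_q}`. [folklore] -/
theorem class_add_fderiv_le (hpb : ∀ φ : EuclideanSpace ℝ ι, |p φ| ≤ Cp * (1 + ‖U' φ‖) ^ np)
    (hp'b : ∀ φ : EuclideanSpace ℝ ι, ‖p' φ‖ ≤ Cp * (1 + ‖U' φ‖) ^ np) (hqb : ∀ φ : EuclideanSpace ℝ ι, |q φ| ≤ Cq * (1 + ‖U' φ‖) ^ nq)
    (hq'b : ∀ φ : EuclideanSpace ℝ ι, ‖q' φ‖ ≤ Cq * (1 + ‖U' φ‖) ^ nq) (φ : EuclideanSpace ℝ ι) :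
    ‖p' φ + q' φ‖ ≤ (Cp + Cq) * (1 + ‖U' φ‖) ^ (np + nq) := by
  have hCp := class_const_nonneg hpb
  have hCq := class_const_nonneg hqb
  have h1 : ‖p' φ‖ ≤ Cp * (1 + ‖U' φ‖) ^ (np + nq) := (hp'b φ).trans (mul_le_mul_of_nonneg_left (growth_pow_mono φ np nq) hCp)
  have h2 : ‖q' φ‖ ≤ Cq * (1 + ‖U' φ‖) ^ (np + nq) := by
    have h := (hq'b φ).trans (mul_le_mul_of_nonneg_left (growth_pow_mono φ nq np) hCq)
    rwa [Nat.add_comm] at h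
  calc ‖p' φ + q' φ‖ ≤ ‖p' φ‖ + ‖q' φ‖ := norm_add_le _ _
    _ ≤ (Cp + Cq) * (1 + ‖U' φ‖) ^ (np + nq) := by rw [add_mul]; exact add_le_add h1 h2

omit [DecidableEq ι] in
/-- **Closed under differences, values**: `|p − q| ≤ (C_p + C_q)(1+‖U′‖)^{n_p+n_q}`. [folklore] -/
theorem class_sub_abs_le (hpb : ∀ φ : EuclideanSpace ℝ ι, |p φ| ≤ Cp * (1 + ‖U' φ‖) ^ np) (hqb : ∀ φ : EuclideanSpace ℝ ι, |q φ| ≤ Cq * (1 + ‖U' φ‖)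
    ^ nq)
    (φ : EuclideanSpace ℝ ι) : |p φ - q φ| ≤ (Cp + Cq) * (1 + ‖U' φ‖) ^ (np + nq) := by
  have h := class_add_abs_le (q := fun φ => -q φ) hpb (fun φ => by rw [abs_neg]; exact hqb φ) φ
  simpa only [sub_eq_add_neg] using h

omit [DecidableEq ι] in
/-- **Closed under differences, derivatives**: `‖p′ − q′‖ ≤ (C_p + C_q)(1+‖U′‖)^{n_p+n_q}`. [folklore] -/
theorem class_sub_fderiv_le (hpb : ∀ φ : EuclideanSpace ℝ ι, |p φ| ≤ Cp * (1 + ‖U' φ‖) ^ np)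
    (hp'b : ∀ φ : EuclideanSpace ℝ ι, ‖p' φ‖ ≤ Cp * (1 + ‖U' φ‖) ^ np) (hqb : ∀ φ : EuclideanSpace ℝ ι, |q φ| ≤ Cq * (1 + ‖U' φ‖) ^ nq)
    (hq'b : ∀ φ : EuclideanSpace ℝ ι, ‖q' φ‖ ≤ Cq * (1 + ‖U' φ‖) ^ nq) (φ : EuclideanSpace ℝ ι) :
    ‖p' φ - q' φ‖ ≤ (Cp + Cq) * (1 + ‖U' φ‖) ^ (np + nq) := by
  have h := class_add_fderiv_le (q := fun φ => -q φ) (q' := fun φ => -q' φ) hpb hp'b (fun φ => by rw [abs_neg]; exact hqb φ)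
    (fun φ => by rw [norm_neg]; exact hq'b φ) φ
  simpa only [sub_eq_add_neg] using h

omit [DecidableEq ι] in
/-- **Closed under scalar multiples, values**: `|c·p| ≤ |c|C_p(1+‖U′‖)^{n_p}`. [folklore] -/
theorem class_smul_abs_le (hpb : ∀ φ : EuclideanSpace ℝ ι, |p φ| ≤ Cp * (1 + ‖U' φ‖) ^ np) (c : ℝ) (φ : EuclideanSpace ℝ ι) :
    |c * p φ| ≤ |c| * Cp * (1 + ‖U' φ‖) ^ np := by
  rw [abs_mul, mul_assoc]
  exact mul_le_mul_of_nonneg_left (hpb φ) (abs_nonneg c)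

omit [DecidableEq ι] in
/-- **Closed under scalar multiples, derivatives**: `‖c·p′‖ ≤ |c|C_p(1+‖U′‖)^{n_p}`. [folklore] -/
theorem class_smul_fderiv_le (hp'b : ∀ φ : EuclideanSpace ℝ ι, ‖p' φ‖ ≤ Cp * (1 + ‖U' φ‖) ^ np) (c : ℝ) (φ : EuclideanSpace ℝ ι) :
    ‖c • p' φ‖ ≤ |c| * Cp * (1 + ‖U' φ‖) ^ np := by
  rw [norm_smul, Real.norm_eq_abs, mul_assoc]
  exact mul_le_mul_of_nonneg_left (hp'b φ) (abs_nonneg c)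

omit [Fintype ι] [DecidableEq ι] in
/-- The derivative of a sum is continuous if both derivatives are. [folklore] -/
theorem class_add_fderiv_continuous (hp'c : Continuous p') (hq'c : Continuous q') : Continuous fun φ : EuclideanSpace ℝ ι => p' φ + q' φ :=
  hp'c.add hq'c

omit [Fintype ι] [DecidableEq ι] in
/-- The derivative of a difference is continuous if both derivatives are. [folklore] -/
theorem class_sub_fderiv_continuous (hp'c : Continuous p') (hq'c : Continuous q') : Continuous fun φ : EuclideanSpace ℝ ι => p' φ - q' φ :=
  hp'c.sub hq'c

/-- Toy (the exponent bookkeeping): `(1+x)² ≤ (1+x)⁵` for `x ≥ 0`. -/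
example (x : ℝ) (hx : 0 ≤ x) : (1 + x) ^ 2 ≤ (1 + x) ^ 5 := pow_le_pow_right₀ (by linarith) (by norm_num)

end Summit.QuantumFields.BalabanUV.T4Continuum.NE7b.SupGrowthClassLinear

end
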